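import Literature.AlgebraicGeometry.Motives.DominatedVarietiesFrobeniusSplitting
import Literature.AlgebraicGeometry.Motives.DominatedVarietiesDirectSummand
import HarnessLib

/-!
# Tate classes split along a domination: `Tateᵖ(V) = f* Tateᵖ(U) ⊕ (Tateᵖ(V) ∩ Ker f₊(· ∪ ζ))`

Let `E : GaloisWeilCohomology k K χ` and let `U` (`dim U = M`) be dominated by `V`
(`dim V = N = M + r`) through `f : V ⟶ U` and `ζ ∈ Aʳ(V)_ℚ` with `f₊ ζ ≠ 0` (Kleiman 1968
Prop. 1.2.4; Kahn 2020 Lemma 6.30 (2)): `f₊ ζ = q · 1`, `q ≠ 0`, `f₊ (f* y ∪ ζ) = q y`. The transfer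
`g = f₊ (· ∪ ζ) : H²ᵖ(V) → H²ᵖ(U)` is `Γ_k`-equivariant (`ρ_pushforward_cup`), hence also for the
Tate-twisted actions (`ρTwist_pushforward_cup`), so:

* `g` maps Galois invariants of `H²ᵖ(V)(p)` to those of `H²ᵖ(U)(p)` and Tate classes to Tate classes
  (`pushforward_cup_mem_invariants`, `pushforward_cup_mem_tateClasses`); a class `y` on `U` is Tate
  (resp. invariant) iff `f* y` is (`mem_tateClasses_iff_pullback_mem`, `mem_invariants_iff_pullback_mem`);
* **`Tateᵖ(V) = f* Tateᵖ(U) ⊕ (Tateᵖ(V) ∩ Ker g)`** (`tateClasses_eq_map_pullback_sup_inf_ker`,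
  `disjoint_map_pullback_tateClasses_ker`; the projector `q⁻¹ f* g` of
  `DominatedVarietiesDirectSummand` preserves Tate classes), `f* Tateᵖ(U) = Tateᵖ(V) ∩ f* H²ᵖ(U)`,
  and **`dim Tateᵖ(V) = dim Tateᵖ(U) + dim (Tateᵖ(V) ∩ Ker g)`**;
* **the Tate conjecture splits**: `Tᵖ(V) ⟺ Tᵖ(U) ∧ (every Galois-invariant class in Ker g is
  algebraic)` (`tateConjectureFor_iff_of_pushforward_ne_zero`; Tate 1994 §1 Conj. Tᵖ) — the
  direction `Tᵖ(V) ⇒ Tᵖ(U)` being `tateConjectureFor_of_pushforward_ne_zero`.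

Theorems only (no definition, no named fact, no instance).

## References

* [Tate1994] J. Tate, *Conjectures on algebraic cycles in ℓ-adic cohomology* (Seattle 1991),
  Proc. Sympos. Pure Math. 55.1 (1994), §1 (Conjecture Tᵖ, Tate classes).
* [Kahn2020] B. Kahn, *Zeta and L-functions of varieties and motives* (2020), §3.5.1, §6.9 Lemma 6.30 (2).
* [Kleiman1968AlgebraicCycles] S. Kleiman, *Algebraic cycles and the Weil conjectures* (1968),
  §1.2 Prop. 1.2.4, §1.3.
-/

universe u v

open CategoryTheory AlgebraicGeometry

noncomputable section

namespace Literature.AlgebraicGeometry.Motives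

namespace GaloisWeilCohomology

variable {k : Type u} [Field k] {K : Type v} [Field K] [CharZero K]
  {χ : Field.absoluteGaloisGroup k →* Kˣ} (E : GaloisWeilCohomology k K χ)
variable {N M r : ℕ} {V U : SchemeOver k}

/-! ## `g = f₊ (· ∪ ζ)` and the twisted Galois actions -/

/-- **`(χ(σ)ʲ σ) (f₊ (x ∪ ζ)) = f₊ ((χ(σ)ʲ σ) x ∪ ζ)`**: the transfer `f₊ (· ∪ ζ) : Hⁱ(V) → Hⁱ(U)` is
equivariant for every Tate twist `Hⁱ(-)(j)` of the Galois actions (`ρ_pushforward_cup` and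
linearity). Degrees: `i + i' = 2M`, `i + 2r + i' = 2N`, `M + r = N`. [cite: Tate1994, §1] [cite: Kahn2020, §3.5.1] -/
theorem ρTwist_pushforward_cup (hV : IsSmoothProjective N V) (hU : IsSmoothProjective M U)
    (f : V ⟶ U) (hr : M + r = N) {ζ : E.obj V (2 * r)} (hζ : ζ ∈ E.ratAlgebraicClasses V r)
    {i i' : ℕ} (hi : i + i' = 2 * M) (he' : i + 2 * r + i' = 2 * N) (j : ℤ)
    (σ : Field.absoluteGaloisGroup k) (x : E.obj V i) :
    E.ρTwist U i j σ (E.pushforward (N := N) hU f he' hi (E.cup rfl x ζ)) =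
      E.pushforward (N := N) hU f he' hi (E.cup rfl (E.ρTwist V i j σ x) ζ) := by
  rw [E.ρTwist_apply, E.ρTwist_apply, E.ρ_pushforward_cup hV hU f hr hζ hi he' σ x,
    LinearMap.map_smul₂, map_smul]

/-- **`f₊ (· ∪ ζ)` maps Galois invariants of `Hⁱ(V)(j)` to Galois invariants of `Hⁱ(U)(j)`.**
[cite: Tate1994, §1] -/
theorem pushforward_cup_mem_invariants (hV : IsSmoothProjective N V) (hU : IsSmoothProjective M U)
    (f : V ⟶ U) (hr : M + r = N) {ζ : E.obj V (2 * r)} (hζ : ζ ∈ E.ratAlgebraicClasses V r)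
    {i i' : ℕ} (hi : i + i' = 2 * M) (he' : i + 2 * r + i' = 2 * N) {j : ℤ} {x : E.obj V i}
    (hx : x ∈ (E.ρTwist V i j).invariants) :
    E.pushforward (N := N) hU f he' hi (E.cup rfl x ζ) ∈ (E.ρTwist U i j).invariants := fun σ ↦ by
  rw [E.ρTwist_pushforward_cup hV hU f hr hζ hi he' j σ x, hx σ]

/-- **`f₊ (· ∪ ζ)` maps Tate classes to Tate classes: `g Tateᵖ(V) ⊆ Tateᵖ(U)`** (same open
subgroup). Degrees: `2p + c = 2M`, `2p + 2r + c = 2N`. [cite: Tate1994, §1] -/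
theorem pushforward_cup_mem_tateClasses (hV : IsSmoothProjective N V) (hU : IsSmoothProjective M U)
    (f : V ⟶ U) (hr : M + r = N) {ζ : E.obj V (2 * r)} (hζ : ζ ∈ E.ratAlgebraicClasses V r)
    {p c : ℕ} (hi : 2 * p + c = 2 * M) (he' : 2 * p + 2 * r + c = 2 * N) {x : E.obj V (2 * p)}
    (hx : x ∈ E.tateClasses V p) :
    E.pushforward (N := N) hU f he' hi (E.cup rfl x ζ) ∈ E.tateClasses U p := by
  simp only [GaloisWeilCohomology.tateClasses, mem_smoothInvariants_iff] at hx ⊢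
  obtain ⟨O, hO⟩ := hx
  exact ⟨O, fun σ hσ ↦ by rw [E.ρTwist_pushforward_cup hV hU f hr hζ hi he' _ σ x, hO σ hσ]⟩

/-- **`y ∈ H²ᵖ(U)(p)` is Galois invariant iff `f* y` is**, for `U` dominated by `V`
(`f* y` invariant ⇒ `y = q⁻¹ f₊ (f* y ∪ ζ)` invariant). [cite: Tate1994, §1] -/
theorem mem_invariants_iff_pullback_mem (hV : IsSmoothProjective N V) (hU : IsSmoothProjective M U)
    (f : V ⟶ U) {ζ : E.obj V (2 * r)} (hζ : ζ ∈ E.ratAlgebraicClasses V r)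
    {he : 2 * r + 2 * M = 2 * N} {hd : 0 + 2 * M = 2 * M}
    (hne : E.pushforward (N := N) hU f he hd ζ ≠ 0) {i i' : ℕ} (hi : i + i' = 2 * M)
    (he' : i + 2 * r + i' = 2 * N) {j : ℤ} (y : E.obj U i) :
    y ∈ (E.ρTwist U i j).invariants ↔ E.pullback f i y ∈ (E.ρTwist V i j).invariants := by
  refine ⟨E.pullback_mem_invariants hV hU f, fun h ↦ ?_⟩
  obtain ⟨q, hq⟩ := E.exists_pushforward_eq_ratCast_smul_one hV hU f hζ he hd
  have hq0 : (q : K) ≠ 0 := fun h0 ↦ hne (by rw [hq, h0, zero_smul])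
  have hy : y = (q : K)⁻¹ • E.pushforward (N := N) hU f he' hi (E.cup rfl (E.pullback f i y) ζ) := by
    rw [E.pushforward_pullback_cup_eq_smul hV hU f hq hi he' y, smul_smul, inv_mul_cancel₀ hq0,
      one_smul]
  rw [hy]
  exact Submodule.smul_mem _ _ (E.pushforward_cup_mem_invariants hV hU f (by omega) hζ hi he' h)

/-- **`y ∈ H²ᵖ(U)` is a Tate class iff `f* y` is**, for `U` dominated by `V`. [cite: Tate1994, §1] -/
theorem mem_tateClasses_iff_pullback_mem (hV : IsSmoothProjective N V) (hU : IsSmoothProjective M U)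
    (f : V ⟶ U) {ζ : E.obj V (2 * r)} (hζ : ζ ∈ E.ratAlgebraicClasses V r)
    {he : 2 * r + 2 * M = 2 * N} {hd : 0 + 2 * M = 2 * M}
    (hne : E.pushforward (N := N) hU f he hd ζ ≠ 0) {p c : ℕ} (hi : 2 * p + c = 2 * M)
    (he' : 2 * p + 2 * r + c = 2 * N) (y : E.obj U (2 * p)) :
    y ∈ E.tateClasses U p ↔ E.pullback f (2 * p) y ∈ E.tateClasses V p := by
  refine ⟨E.pullback_mem_tateClasses hV hU f, fun h ↦ ?_⟩
  obtain ⟨q, hq⟩ := E.exists_pushforward_eq_ratCast_smul_one hV hU f hζ he hd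
  have hq0 : (q : K) ≠ 0 := fun h0 ↦ hne (by rw [hq, h0, zero_smul])
  have hy : y = (q : K)⁻¹ •
      E.pushforward (N := N) hU f he' hi (E.cup rfl (E.pullback f (2 * p) y) ζ) := by
    rw [E.pushforward_pullback_cup_eq_smul hV hU f hq hi he' y, smul_smul, inv_mul_cancel₀ hq0,
      one_smul]
  rw [hy]
  exact Submodule.smul_mem _ _ (E.pushforward_cup_mem_tateClasses hV hU f (by omega) hζ hi he' h)

/-- **`f* Tateᵖ(U) = Tateᵖ(V) ∩ f* H²ᵖ(U)`** for `U` dominated by `V`. [cite: Tate1994, §1] -/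
theorem map_pullback_tateClasses_eq_inf (hV : IsSmoothProjective N V) (hU : IsSmoothProjective M U)
    (f : V ⟶ U) {ζ : E.obj V (2 * r)} (hζ : ζ ∈ E.ratAlgebraicClasses V r)
    {he : 2 * r + 2 * M = 2 * N} {hd : 0 + 2 * M = 2 * M}
    (hne : E.pushforward (N := N) hU f he hd ζ ≠ 0) {p c : ℕ} (hi : 2 * p + c = 2 * M)
    (he' : 2 * p + 2 * r + c = 2 * N) :
    (E.tateClasses U p).map (E.pullback f (2 * p)) =
      E.tateClasses V p ⊓ LinearMap.range (E.pullback f (2 * p)) := by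
  refine le_antisymm ?_ ?_
  · rintro _ ⟨y, hy, rfl⟩
    exact ⟨E.pullback_mem_tateClasses hV hU f hy, LinearMap.mem_range_self _ y⟩
  · rintro _ ⟨hx, y, rfl⟩
    exact ⟨y, (E.mem_tateClasses_iff_pullback_mem hV hU f hζ hne hi he' y).mpr hx, rfl⟩

/-! ## The splitting `Tateᵖ(V) = f* Tateᵖ(U) ⊕ (Tateᵖ(V) ∩ Ker g)` -/

/-- **`Tateᵖ(V) = f* Tateᵖ(U) + (Tateᵖ(V) ∩ Ker f₊(· ∪ ζ))`** for `U` dominated by `V`: a Tate class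
`x` decomposes as `x = f* (q⁻¹ g x) + (x - f* (q⁻¹ g x))` with `g x = f₊ (x ∪ ζ)` a Tate class on
`U` (`pushforward_cup_mem_tateClasses`) and `g (x - f* (q⁻¹ g x)) = 0` (`f₊ (f* y ∪ ζ) = q y`,
projection formula, Kahn 2020 §3.5.1). [cite: Tate1994, §1] [cite: Kahn2020, §3.5.1 and §6.9 Lemma 6.30 (2)] -/
theorem tateClasses_eq_map_pullback_sup_inf_ker (hV : IsSmoothProjective N V)
    (hU : IsSmoothProjective M U) (f : V ⟶ U) {ζ : E.obj V (2 * r)}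
    (hζ : ζ ∈ E.ratAlgebraicClasses V r) {he : 2 * r + 2 * M = 2 * N} {hd : 0 + 2 * M = 2 * M}
    (hne : E.pushforward (N := N) hU f he hd ζ ≠ 0) {p c : ℕ} (hi : 2 * p + c = 2 * M)
    (he' : 2 * p + 2 * r + c = 2 * N) :
    E.tateClasses V p =
      (E.tateClasses U p).map (E.pullback f (2 * p)) ⊔
        (E.tateClasses V p ⊓ LinearMap.ker (E.pushforward (N := N) hU f he' hi ∘ₗ
          (E.cup (rfl : 2 * p + 2 * r = 2 * p + 2 * r)).flip ζ)) := by
  obtain ⟨q, hq⟩ := E.exists_pushforward_eq_ratCast_smul_one hV hU f hζ he hd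
  have hq0 : (q : K) ≠ 0 := fun h0 ↦ hne (by rw [hq, h0, zero_smul])
  refine le_antisymm (fun x hx ↦ ?_) (sup_le ?_ inf_le_left)
  · set y : E.obj U (2 * p) :=
      (q : K)⁻¹ • E.pushforward (N := N) hU f he' hi (E.cup rfl x ζ) with hy
    have hyT : y ∈ E.tateClasses U p :=
      Submodule.smul_mem _ _ (E.pushforward_cup_mem_tateClasses hV hU f (by omega) hζ hi he' hx)
    have hsplit : x = E.pullback f (2 * p) y + (x - E.pullback f (2 * p) y) := by abel
    rw [hsplit]
    refine Submodule.add_mem_sup ⟨y, hyT, rfl⟩ (Submodule.mem_inf.mpr ⟨?_, ?_⟩)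
    · exact Submodule.sub_mem _ hx (E.pullback_mem_tateClasses hV hU f hyT)
    · rw [LinearMap.mem_ker, LinearMap.comp_apply, LinearMap.flip_apply, LinearMap.map_sub₂,
        map_sub, hy, map_smul, LinearMap.map_smul₂, map_smul,
        E.pushforward_pullback_cup_eq_smul hV hU f hq hi he', smul_smul, inv_mul_cancel₀ hq0,
        one_smul, sub_self]
  · rintro _ ⟨y, hy, rfl⟩
    exact E.pullback_mem_tateClasses hV hU f hy

/-- **`f* Tateᵖ(U) ∩ Ker f₊(· ∪ ζ) = 0`** (indeed `f* H²ᵖ(U) ∩ Ker f₊(· ∪ ζ) = 0`,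
`isCompl_range_pullback_ker_pushforward_cup`). [cite: Kahn2020, §6.9 Lemma 6.30 (2)] -/
theorem disjoint_map_pullback_tateClasses_ker (hV : IsSmoothProjective N V)
    (hU : IsSmoothProjective M U) (f : V ⟶ U) {ζ : E.obj V (2 * r)}
    (hζ : ζ ∈ E.ratAlgebraicClasses V r) {he : 2 * r + 2 * M = 2 * N} {hd : 0 + 2 * M = 2 * M}
    (hne : E.pushforward (N := N) hU f he hd ζ ≠ 0) {p c : ℕ} (hi : 2 * p + c = 2 * M)
    (he' : 2 * p + 2 * r + c = 2 * N) :
    Disjoint ((E.tateClasses U p).map (E.pullback f (2 * p)))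
      (E.tateClasses V p ⊓ LinearMap.ker (E.pushforward (N := N) hU f he' hi ∘ₗ
        (E.cup (rfl : 2 * p + 2 * r = 2 * p + 2 * r)).flip ζ)) :=
  ((E.isCompl_range_pullback_ker_pushforward_cup hV hU f hζ hne hi he').disjoint.mono_left
    LinearMap.map_le_range).mono_right inf_le_right

/-- **`dim Tateᵖ(V) = dim Tateᵖ(U) + dim (Tateᵖ(V) ∩ Ker f₊(· ∪ ζ))`** for `U` dominated by `V`
(the splitting `Tateᵖ(V) = f* Tateᵖ(U) ⊕ (Tateᵖ(V) ∩ Ker g)`, `f*` injective).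
[cite: Tate1994, §1] [cite: Kleiman1968AlgebraicCycles, §1.2 Prop. 1.2.4] -/
theorem finrank_tateClasses_eq_add (hV : IsSmoothProjective N V) (hU : IsSmoothProjective M U)
    (f : V ⟶ U) {ζ : E.obj V (2 * r)} (hζ : ζ ∈ E.ratAlgebraicClasses V r)
    {he : 2 * r + 2 * M = 2 * N} {hd : 0 + 2 * M = 2 * M}
    (hne : E.pushforward (N := N) hU f he hd ζ ≠ 0) {p c : ℕ} (hi : 2 * p + c = 2 * M)
    (he' : 2 * p + 2 * r + c = 2 * N) :
    Module.finrank K (E.tateClasses V p) = Module.finrank K (E.tateClasses U p) +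
      Module.finrank K ↥(E.tateClasses V p ⊓ LinearMap.ker (E.pushforward (N := N) hU f he' hi ∘ₗ
        (E.cup (rfl : 2 * p + 2 * r = 2 * p + 2 * r)).flip ζ)) := by
  haveI := E.finite_obj hV (2 * p)
  have hsup := Submodule.finrank_sup_add_finrank_inf_eq
    ((E.tateClasses U p).map (E.pullback f (2 * p)))
    (E.tateClasses V p ⊓ LinearMap.ker (E.pushforward (N := N) hU f he' hi ∘ₗ
      (E.cup (rfl : 2 * p + 2 * r = 2 * p + 2 * r)).flip ζ))
  rw [← E.tateClasses_eq_map_pullback_sup_inf_ker hV hU f hζ hne hi he',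
    (E.disjoint_map_pullback_tateClasses_ker hV hU f hζ hne hi he').eq_bot, finrank_bot, add_zero,
    ← LinearEquiv.finrank_eq (Submodule.equivMapOfInjective _
      (E.pullback_injective_of_pushforward_ne_zero hV hU f hζ hne (2 * p)) _)] at hsup
  exact hsup

/-! ## The Tate conjecture splits along a domination -/

/-- **`Tᵖ(V) ⟺ Tᵖ(U) ∧ (every Galois-invariant class in `Ker f₊(· ∪ ζ) ⊆ H²ᵖ(V)(p)` is
algebraic)`** for `U` dominated by `V` (Tate 1994 §1, Conjecture Tᵖ): `⇒` is
`tateConjectureFor_of_pushforward_ne_zero` plus restriction; for `⇐`, an invariant `x` on `V` is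
`f* y + z` with `y = q⁻¹ f₊ (x ∪ ζ)` invariant on `U` — hence algebraic by `Tᵖ(U)`, so `f* y` is
algebraic — and `z ∈ Ker g` invariant, hence algebraic by hypothesis. Degrees: `2p + c = 2M`,
`2p + 2r + c = 2N`. [cite: Tate1994, §1 (Conjecture Tᵖ)] [cite: Kahn2020, §6.9 Lemma 6.30 (2)] -/
theorem tateConjectureFor_iff_of_pushforward_ne_zero (hV : IsSmoothProjective N V)
    (hU : IsSmoothProjective M U) (f : V ⟶ U) {ζ : E.obj V (2 * r)}
    (hζ : ζ ∈ E.ratAlgebraicClasses V r) {he : 2 * r + 2 * M = 2 * N} {hd : 0 + 2 * M = 2 * M}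
    (hne : E.pushforward (N := N) hU f he hd ζ ≠ 0) {p c : ℕ} (hi : 2 * p + c = 2 * M)
    (he' : 2 * p + 2 * r + c = 2 * N) :
    E.TateConjectureFor V p ↔ E.TateConjectureFor U p ∧
      ∀ x ∈ (E.ρTwist V (2 * p) p).invariants,
        E.pushforward (N := N) hU f he' hi (E.cup rfl x ζ) = 0 → x ∈ E.algebraicClasses V p := by
  refine ⟨fun hT ↦ ⟨E.tateConjectureFor_of_pushforward_ne_zero hV hU f hζ hne hT, fun x hx _ ↦ ?_⟩,
    fun ⟨hTU, hker⟩ ↦ ?_⟩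
  · exact ((tateConjectureFor_iff_invariants_le E hV p).mp hT) hx
  · rw [tateConjectureFor_iff_invariants_le E hV p]
    intro x hx
    obtain ⟨q, hq⟩ := E.exists_pushforward_eq_ratCast_smul_one hV hU f hζ he hd
    have hq0 : (q : K) ≠ 0 := fun h0 ↦ hne (by rw [hq, h0, zero_smul])
    set y : E.obj U (2 * p) :=
      (q : K)⁻¹ • E.pushforward (N := N) hU f he' hi (E.cup rfl x ζ) with hy
    have hyI : y ∈ (E.ρTwist U (2 * p) p).invariants :=
      Submodule.smul_mem _ _ (E.pushforward_cup_mem_invariants hV hU f (by omega) hζ hi he' hx)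
    have hyA : E.pullback f (2 * p) y ∈ E.algebraicClasses V p :=
      E.map_algebraicClasses_le_of_ratAlgebraicClasses (E.pullback f (2 * p))
        (fun z hz ↦ E.pullback_ratAlgebraicClasses_le hV hU f p ⟨z, hz, rfl⟩)
        ⟨y, ((tateConjectureFor_iff_invariants_le E hU p).mp hTU) hyI, rfl⟩
    have hz : x - E.pullback f (2 * p) y ∈ E.algebraicClasses V p := by
      refine hker _ (Submodule.sub_mem _ hx (E.pullback_mem_invariants hV hU f hyI)) ?_
      rw [LinearMap.map_sub₂, map_sub, hy, map_smul, LinearMap.map_smul₂, map_smul,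
        E.pushforward_pullback_cup_eq_smul hV hU f hq hi he', smul_smul, inv_mul_cancel₀ hq0,
        one_smul, sub_self]
    have hsplit : x = E.pullback f (2 * p) y + (x - E.pullback f (2 * p) y) := by abel
    rw [hsplit]
    exact add_mem hyA hz

/-- **`Tateᵖ(V) ⊆ K·Aᵖ(V) ⟺ Tateᵖ(U) ⊆ K·Aᵖ(U) ∧ (Tateᵖ(V) ∩ Ker f₊(· ∪ ζ) ⊆ K·Aᵖ(V))`** for `U`
dominated by `V` (the same splitting for Tate classes — invariants of open subgroups, i.e. the Tate
conjecture over all finite extensions; Tate 1994 §1). [cite: Tate1994, §1] [cite: Kahn2020, §6.9 Lemma 6.30 (2)] -/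
theorem tateClasses_le_algebraicClasses_iff_of_pushforward_ne_zero (hV : IsSmoothProjective N V)
    (hU : IsSmoothProjective M U) (f : V ⟶ U) {ζ : E.obj V (2 * r)}
    (hζ : ζ ∈ E.ratAlgebraicClasses V r) {he : 2 * r + 2 * M = 2 * N} {hd : 0 + 2 * M = 2 * M}
    (hne : E.pushforward (N := N) hU f he hd ζ ≠ 0) {p c : ℕ} (hi : 2 * p + c = 2 * M)
    (he' : 2 * p + 2 * r + c = 2 * N) :
    E.tateClasses V p ≤ E.algebraicClasses V p ↔ E.tateClasses U p ≤ E.algebraicClasses U p ∧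
      E.tateClasses V p ⊓ LinearMap.ker (E.pushforward (N := N) hU f he' hi ∘ₗ
        (E.cup (rfl : 2 * p + 2 * r = 2 * p + 2 * r)).flip ζ) ≤ E.algebraicClasses V p := by
  refine ⟨fun hT ↦ ⟨fun y hy ↦ ?_, fun x hx ↦ hT hx.1⟩, fun ⟨hTU, hker⟩ ↦ ?_⟩
  · exact E.mem_algebraicClasses_of_pullback_mem hV hU f hζ hne (hT (E.pullback_mem_tateClasses hV hU f hy))
  · rw [E.tateClasses_eq_map_pullback_sup_inf_ker hV hU f hζ hne hi he']
    refine sup_le ?_ hker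
    rintro _ ⟨y, hy, rfl⟩
    exact E.map_algebraicClasses_le_of_ratAlgebraicClasses (E.pullback f (2 * p))
      (fun z hz ↦ E.pullback_ratAlgebraicClasses_le hV hU f p ⟨z, hz, rfl⟩) ⟨y, hTU hy, rfl⟩

end GaloisWeilCohomology

end Literature.AlgebraicGeometry.Motives
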